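import Mathlib.Analysis.InnerProductSpace.Calculus
import Mathlib.Analysis.Normed.Group.Bounded
import Literature.Geometry.Lorentzian.AsymptoticFlatness
import Literature.Geometry.Lorentzian.HypersurfaceRestriction
import HarnessLib

/-!
# Chart calculus on an asymptotically flat end (PMT-free leaf)

A leaf module (import hygiene, work item `wi-37265`): the five chart-calculus lemmas that
`AsymptoticallyFlatChart.lean` used to take from `AsymptoticallyFlatCompleteness.lean` — whose
genuine content (geodesic completeness of a sole asymptotically flat end) imports
`PositiveMassRigidity` / `MassInequalities` and with them eleven undischarged named facts — are
proved here from `AsymptoticFlatness` and `HypersurfaceRestriction` alone, in the slightly more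
general "operator" forms from which the pointwise statements of the other files are one-line
consequences:

* (`AFEnd.hCoeff_of_lt` of `AsymptoticFlatness.lean` — at a point `y` with `R < ‖y‖` the chart
  components of the metric are the pullback of `h` along the inverse chart — replaces the subtype
  form `hCoeff_coe`);
* `AFEnd.dataChart_comp_chart` — `Φ ∘ chart = ι`, the inclusion of the open end;
* `AFEnd.mfderiv_dataChart_comp_mfderiv_chart` — `dΦ_{chart q} ∘ dchart_q = id` (chain rule and
  `mfderiv_subtypeVal`);
* `AFEnd.pullbackBilin_dataChart_apply_mfderiv_chart` — `(Φ^* h)_{chart q}(dchart v, dchart w) = h_q(v, w)`,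
  hence `AFEnd.hCoeff_chart_apply_mfderiv_mfderiv`: `h_ij(chart q)(dchart v)ⁱ(dchart w)ʲ = h_q(v, w)`
  (Bartnik 1986, (1.3), read backwards);
* `AFEnd.exists_radius_norm_sq_le_of_le` — order-zero decay `h_ij - (1 + 2M/r)δ_ij = o(r^{-β})`,
  `β ≥ 0`, gives, beyond any prescribed threshold `R₀`, a radius `R₁` with `‖w‖² ≤ 2 h_ij(y) wⁱ wʲ`
  for `‖y‖ ≥ R₁` (Schoen–Yau 1979, p. 63: the uniform equivalence of `ds²` with the Euclidean
  metric on the end).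

Everything is proved; no definitions.

## References

* R. Bartnik, *The mass of an asymptotically flat manifold*, Comm. Pure Appl. Math. 39 (1986)
  661–693, §1, (1.3).
* R. Schoen, S.-T. Yau, *On the proof of the positive mass conjecture in general relativity*,
  Comm. Math. Phys. 65 (1979) 45–76, §3 (p. 63).
-/

noncomputable section

open Bundle Set Filter Metric Asymptotics
open scoped Manifold ContDiff Topology

namespace Literature.Geometry.Lorentzian

namespace AFEnd

variable {X : Type} [TopologicalSpace X] [ChartedSpace E3 X] [IsManifold (𝓡 3) ∞ X]
  (e : AFEnd X) (D : InitialDataSet (𝓡 3) X)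

/-! ### The chart of the end and the metric -/

omit [IsManifold (𝓡 3) ∞ X] in
/-- The inverse chart undoes the chart: `Φ ∘ chart = ι`, the inclusion of the open end.
Bartnik 1986, §1. [cite: Bartnik1986, §1] -/
theorem dataChart_comp_chart : e.dataChart ∘ e.chart = (Subtype.val : e.U → X) := by
  funext q
  simp [dataChart]

omit [IsManifold (𝓡 3) ∞ X] in
/-- **`dΦ ∘ dchart = id`**: the differential of the inverse chart at `chart q` composed with the
differential of the chart at `q` is the identity of `T_q X` (chain rule for `Φ ∘ chart = ι`, whose
differential is the identity, `mfderiv_subtypeVal`). Bartnik 1986, §1. [cite: Bartnik1986, §1] -/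
theorem mfderiv_dataChart_comp_mfderiv_chart (q : e.U) :
    (mfderiv (𝓡 3) (𝓡 3) e.dataChart (e.chart q)).comp (mfderiv (𝓡 3) (𝓡 3) e.chart q) =
      ContinuousLinearMap.id ℝ (TangentSpace (𝓡 3) q) := by
  have hc : MDifferentiableAt (𝓡 3) (𝓡 3) e.chart q :=
    e.chart.contMDiff.mdifferentiableAt (by simp)
  have hd : MDifferentiableAt (𝓡 3) (𝓡 3) e.dataChart (e.chart q) :=
    (e.contMDiff_dataChart _).mdifferentiableAt (by simp)
  rw [← mfderiv_comp q hd hc, dataChart_comp_chart, mfderiv_subtypeVal]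
  rfl

/-- **The pullback metric evaluates the metric**: `(Φ^* h)_{chart q}(dchart_q v, dchart_q w) = h_q(v, w)`
for a point `q` of the end and tangent vectors `v, w` at `q` — the defining property of the chart
components `(Φ^* h)_ij` (Bartnik 1986, (1.3)) read backwards through `Φ (chart q) = q`,
`dΦ ∘ dchart = id`. [cite: Bartnik1986, (1.3)] -/
theorem pullbackBilin_dataChart_apply_mfderiv_chart (q : e.U) (v w : TangentSpace (𝓡 3) q) :
    pullbackBilin (I := 𝓡 3) (I' := 𝓡 3) e.dataChart D.h.inner (e.chart q)
      (mfderiv (𝓡 3) (𝓡 3) e.chart q v) (mfderiv (𝓡 3) (𝓡 3) e.chart q w) = D.h.inner (q : X) v w := by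
  have hq : e.dataChart (e.chart q) = (q : X) := congr_fun e.dataChart_comp_chart q
  have hv : mfderiv (𝓡 3) (𝓡 3) e.dataChart (e.chart q) (mfderiv (𝓡 3) (𝓡 3) e.chart q v) = v :=
    DFunLike.congr_fun (e.mfderiv_dataChart_comp_mfderiv_chart q) v
  have hw : mfderiv (𝓡 3) (𝓡 3) e.dataChart (e.chart q) (mfderiv (𝓡 3) (𝓡 3) e.chart q w) = w :=
    DFunLike.congr_fun (e.mfderiv_dataChart_comp_mfderiv_chart q) w
  have key : ∀ (a : X) (_ : a = (q : X)) (v' : E3) (_ : v' = v) (w' : E3) (_ : w' = w),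
      D.h.inner a v' w' = D.h.inner (q : X) v w := by
    rintro a rfl v' rfl w' rfl
    rfl
  rw [pullbackBilin_apply]
  exact key _ hq _ hv _ hw

/-- **The chart components evaluate the metric** (two-vector form through `hCoeff`):
`h_ij(chart q)(dchart v)ⁱ(dchart w)ʲ = h_q(v, w)`. Bartnik 1986, (1.3). [cite: Bartnik1986, (1.3)] -/
theorem hCoeff_chart_apply_mfderiv_mfderiv (q : e.U) (v w : TangentSpace (𝓡 3) q) :
    hCoeff e D (e.chart q : E3) (mfderiv (𝓡 3) (𝓡 3) e.chart q v) (mfderiv (𝓡 3) (𝓡 3) e.chart q w) =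
      D.h.inner (q : X) v w := by
  rw [hCoeff_of_lt D (e.chart q).2, Subtype.coe_eta]
  exact e.pullbackBilin_dataChart_apply_mfderiv_chart D q v w

/-! ### Order-zero decay: the chart norm is dominated by the metric far out -/

-- the operator norm on `E3 →L[ℝ] E3 →L[ℝ] ℝ` is slow to synthesize through `PiLp`
set_option synthInstance.maxHeartbeats 80000 in
variable {e D} in
/-- **Far out, the coordinate norm is controlled by the metric** (with a prescribed threshold). If
`h_ij - (1 + 2M/r) δ_ij = o(r^{-β})` in the chart of the end with `β ≥ 0` (the order-zero clause
of `IsStronglyAsymptoticallyFlatWith e D M β γ nh nk`), then for every `R₀` there is `R₁ ≥ R₀`,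
`R₁ > R`, `R₁ > 0`, such that `‖w‖² ≤ 2 h_ij(y) wⁱ wʲ` for all `‖y‖ ≥ R₁` and `w ∈ ℝ³`: for large `r`
the operator norm of `h(y) - (1 + 2M/r) δ` is at most `1/4` and `|2M/r| ≤ 1/4`, so
`h(y)(w, w) ≥ ‖w‖²/2` (the uniform equivalence of `ds²` with the Euclidean metric on the end,
Schoen–Yau 1979, p. 63). [cite: SchoenYauPMT1979, §3 p. 63] -/
theorem exists_radius_norm_sq_le_of_le {M β γ : ℝ} {nh nk : ℕ} (hβ : 0 ≤ β)
    (h : e.IsStronglyAsymptoticallyFlatWith D M β γ nh nk) (R₀ : ℝ) :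
    ∃ R₁ : ℝ, R₀ ≤ R₁ ∧ e.R < R₁ ∧ 0 < R₁ ∧
      ∀ y : E3, R₁ ≤ ‖y‖ → ∀ w : E3, ‖w‖ ^ 2 ≤ 2 * hCoeff e D y w w := by
  have h0 := h.1 0 (Nat.zero_le _)
  have h1 : ∀ᶠ y in Bornology.cobounded E3,
      ‖hCoeff e D y - (1 + 2 * M / ‖y‖) • (innerSL ℝ : E3 →L[ℝ] E3 →L[ℝ] ℝ)‖ ≤ 1 / 4 := by
    filter_upwards [h0.def (show (0 : ℝ) < 1 / 4 by norm_num),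
      eventually_cobounded_le_norm (E := E3) 1] with y hy hy1
    rw [norm_iteratedFDeriv_zero, norm_norm] at hy
    refine hy.trans ?_
    have h2 : ‖y‖ ^ (-β - ((0 : ℕ) : ℝ)) ≤ 1 := by
      rw [Nat.cast_zero, sub_zero]
      exact Real.rpow_le_one_of_one_le_of_nonpos hy1 (by linarith)
    rw [Real.norm_of_nonneg (Real.rpow_nonneg (norm_nonneg _) _)]
    calc 1 / 4 * ‖y‖ ^ (-β - ((0 : ℕ) : ℝ)) ≤ 1 / 4 * 1 := mul_le_mul_of_nonneg_left h2 (by norm_num)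
      _ = 1 / 4 := by norm_num
  have h3 : ∀ᶠ y in Bornology.cobounded E3, |2 * M / ‖y‖| ≤ 1 / 4 := by
    filter_upwards [eventually_cobounded_le_norm (E := E3) (8 * |M| + 1)] with y hy
    have hypos : 0 < ‖y‖ := by linarith [abs_nonneg M]
    rw [abs_div, abs_norm, div_le_iff₀ hypos, abs_mul, abs_two]
    nlinarith [abs_nonneg M]
  obtain ⟨r, -, hr⟩ := (Filter.hasBasis_cobounded_norm (E := E3)).eventually_iff.1 (h1.and h3)
  refine ⟨max (max r (e.R + 1)) R₀, le_max_right _ _,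
    lt_of_lt_of_le (by linarith) ((le_max_right _ _).trans (le_max_left _ _)),
    lt_of_lt_of_le (by linarith [e.R_pos]) ((le_max_right _ _).trans (le_max_left _ _)), fun y hy w ↦ ?_⟩
  obtain ⟨hA, hM⟩ := hr (show r ≤ ‖y‖ from ((le_max_left _ _).trans (le_max_left _ _)).trans hy)
  set A := hCoeff e D y - (1 + 2 * M / ‖y‖) • (innerSL ℝ : E3 →L[ℝ] E3 →L[ℝ] ℝ) with hA_def
  have hδ : (innerSL ℝ : E3 →L[ℝ] E3 →L[ℝ] ℝ) w w = ‖w‖ ^ 2 := by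
    rw [← real_inner_self_eq_norm_sq]
    rfl
  have hdec : hCoeff e D y w w = A w w + (1 + 2 * M / ‖y‖) * ‖w‖ ^ 2 := by
    simp only [hA_def, FunLike.coe_sub, Pi.sub_apply, FunLike.coe_smul, Pi.smul_apply, smul_eq_mul, hδ]
    ring
  have hAw : |A w w| ≤ 1 / 4 * ‖w‖ ^ 2 := by
    rw [← Real.norm_eq_abs]
    calc ‖A w w‖ ≤ ‖A‖ * ‖w‖ * ‖w‖ := A.le_opNorm₂ w w
      _ ≤ 1 / 4 * ‖w‖ * ‖w‖ := by gcongr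
      _ = 1 / 4 * ‖w‖ ^ 2 := by ring
  have hM' : 3 / 4 ≤ 1 + 2 * M / ‖y‖ := by linarith [(abs_le.1 hM).1]
  rw [hdec]
  nlinarith [(abs_le.1 hAw).1, sq_nonneg ‖w‖]

end AFEnd

end Literature.Geometry.Lorentzian
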